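import Mathlib
import Summits.Ventures.PercRepro2.SwOutCoreDefs
import Summits.Ventures.PercRepro2.SwOutAll

/-!
# The multi-root core cube: the base and the avoidance lemmas (blind cell PercRepro2, night-4 g34,
2026-08-29; proofs/NIGHT4-G34.md §6)

g13's core cube has two ROOTS, `h` and the junction `u`; its arms are the components of the extended
hull without the roots.  THE MULTI-ROOT CORE CUBE has any set `R ∋ h` of roots (the non-escaping
junctions of a class together with `h`): a base configuration `ζ` in which every edge at a root is
red (`root_red`), every edge from the extended hull `H` to the outside is blue (`bdry_blue`), the arms
`A i` are pairwise disjoint, cover `H ∖ R`, carry no edge between two different arms (`no_cross`), and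
every vertex of an arm is red-connected inside the arm to some root (`conn`).  A cube point
`ω : Config ι` realises `coreReal ends A ζ ω` — the arms assigned `false` flipped (g13's realisation,
unchanged).

The AVOIDANCE LEMMAS replace g13's explicit cluster formulas: at a cube point, a red path from a root
visits only roots and `true` arms (`mem_root_or_true_of_mem_cluster`), a blue path from a root only
roots and `false` arms, a red path from OUTSIDE the extended hull visits only outside vertices and
`false` arms (`mem_notMem_or_false_of_mem_cluster_out`, never a root), a blue one only `true` arms
(`mem_notMem_or_true_of_mem_cluster_blue_out`).  Every monotonicity of the cube (next file) follows
from these four closure statements.  Census (mining/night-4/g34/mrcube.py): the multi-root cubes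
partition the non-escaping parts of all 364 uncovered mark-step classes at `n = 6` whose junctions
cannot escape in blue — 3,127 cubes, 4,621 points, the side a lower set on each cube, Hall on each.
-/

namespace Summit.Ventures.PercRepro2

namespace LocRows

open Hull

variable {V : Type*} {E : Type*}

open scoped Classical

variable {ends : E → Sym2 V}

/-- **The data of a multi-root core cube**: a base configuration `ζ`, the roots `R`, the extended
hull `H ⊇ R`, and the arms `A i` (pairwise disjoint, nonempty, covering `H ∖ R`, no edge between two
arms, every edge from `H` to the outside blue); every edge at a root goes into an arm and is red;
every vertex of an arm is red-connected inside the arm to some root. -/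
structure MultiBase (ends : E → Sym2 V) (ζ : Config E) (R : Set V) (H : Set V) {ι : Type*}
    (A : ι → Set V) : Prop where
  root_sub : R ⊆ H
  bdry_blue : ∀ e x y, ends e = s(x, y) → x ∈ H → y ∉ H → ζ e = false
  arm_sub : ∀ i, ∀ x ∈ A i, x ∈ H ∧ x ∉ R
  arm_nonempty : ∀ i, (A i).Nonempty
  arm_disj : ∀ i j, i ≠ j → ∀ x, x ∈ A i → x ∉ A j
  arm_cover : ∀ x ∈ H, x ∉ R → ∃ i, x ∈ A i
  no_cross : ∀ i j, i ≠ j → ∀ e x y, ends e = s(x, y) → x ∈ A i → y ∈ A j → False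
  root_edges : ∀ e r x, r ∈ R → ends e = s(r, x) → ∃ i, x ∈ A i
  root_red : ∀ e r x, r ∈ R → ends e = s(r, x) → ζ e = true
  conn : ∀ i, ∀ x ∈ A i, ∃ r ∈ R, x ∈ cluster ends (insideConfig ends (A i ∪ {r}) ζ) r

section Base

variable {ι : Type*} {A : ι → Set V} {ζ : Config E} {R H : Set V}
  (hb : MultiBase ends ζ R H A)
include hb

/-- A root lies in no arm. -/
lemma MultiBase.root_notMem_arm {r : V} (hr : r ∈ R) (i : ι) : r ∉ A i :=
  fun h' => (hb.arm_sub i r h').2 hr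

/-- No loop at a root. -/
lemma MultiBase.loop_root {r : V} (hr : r ∈ R) (e : E) : ends e ≠ s(r, r) := by
  intro he
  obtain ⟨i, hi⟩ := hb.root_edges e r r hr he
  exact hb.root_notMem_arm hr i hi

/-- No edge joins two roots. -/
lemma MultiBase.no_root_root {r r' : V} (hr : r ∈ R) (hr' : r' ∈ R) (e : E) :
    ends e ≠ s(r, r') := by
  intro he
  obtain ⟨i, hi⟩ := hb.root_edges e r r' hr he
  exact hb.root_notMem_arm hr' i hi

/-- The two ends of an edge in arms lie in the same arm. -/
lemma MultiBase.arm_eq_of_edge {i j : ι} {e : E} {x y : V} (hxy : ends e = s(x, y)) (hx : x ∈ A i)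
    (hy : y ∈ A j) : i = j := by
  by_contra hij
  exact hb.no_cross i j hij e x y hxy hx hy

/-- An edge with an end in `A i` touches the arms assigned `false` iff `ω i = false`. -/
lemma MultiBase.touches_armsFalseC_iff {ω : Config ι} {i : ι} {e : E} {x y : V}
    (hxy : ends e = s(x, y)) (hx : x ∈ A i) :
    e ∈ touches ends (armsFalseC A ω) ↔ ω i = false := by
  constructor
  · rintro ⟨z, ⟨j, hj, hz⟩, w, hzw⟩
    rw [hxy, Sym2.eq_iff] at hzw
    rcases hzw with ⟨h1, _⟩ | ⟨_, h2⟩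
    · rw [← h1] at hz
      have hji : j = i := by
        by_contra hne
        exact hb.arm_disj j i hne x hz hx
      rw [← hji]; exact hj
    · rw [← h2] at hz
      have hij : i = j := hb.arm_eq_of_edge hxy hx hz
      rw [hij]; exact hj
  · intro hi
    exact ⟨x, ⟨i, hi, hx⟩, y, hxy⟩

/-- The value of a realisation on an edge with an end in `A i`. -/
lemma MultiBase.coreReal_apply_of_mem {ω : Config ι} {i : ι} {e : E} {x y : V}
    (hxy : ends e = s(x, y)) (hx : x ∈ A i) :
    coreReal ends A ζ ω e = (if ω i = true then ζ e else !ζ e) := by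
  unfold coreReal
  by_cases hi : ω i = true
  · rw [flip_apply_of_notMem, if_pos hi]
    rw [hb.touches_armsFalseC_iff hxy hx, hi]; decide
  · rw [flip_apply_of_mem, if_neg hi]
    rw [hb.touches_armsFalseC_iff hxy hx]
    simpa using hi

omit hb in
/-- The value of a realisation on an edge with no end in an arm. -/
lemma MultiBase.coreReal_apply_of_notMem {ω : Config ι} {e : E}
    (he : e ∉ touches ends (allArms A)) : coreReal ends A ζ ω e = ζ e := by
  unfold coreReal
  rw [flip_apply_of_notMem]
  exact fun h' => he (touches_mono (armsFalseC_subset_allArms ω) h')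

/-- An edge at a root with its other end in `A i` is red at a cube point iff `ω i = true`. -/
lemma MultiBase.coreReal_root_edge {ω : Config ι} {i : ι} {e : E} {r x : V} (hr : r ∈ R)
    (hrx : ends e = s(r, x)) (hx : x ∈ A i) : coreReal ends A ζ ω e = true ↔ ω i = true := by
  rw [hb.coreReal_apply_of_mem (ends_swap hrx) hx, hb.root_red e r x hr hrx]
  by_cases hi : ω i = true <;> simp [hi]

/-- An edge from `A i` to the outside of `H` is red at a cube point iff `ω i = false`. -/
lemma MultiBase.coreReal_out_edge {ω : Config ι} {i : ι} {e : E} {x y : V}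
    (hxy : ends e = s(x, y)) (hx : x ∈ A i) (hy : y ∉ H) :
    coreReal ends A ζ ω e = true ↔ ω i = false := by
  rw [hb.coreReal_apply_of_mem hxy hx, hb.bdry_blue e x y hxy (hb.arm_sub i x hx).1 hy]
  by_cases hi : ω i = true <;> simp [hi]

/-- A vertex adjacent to a root lies in an arm (in particular in `H`). -/
lemma MultiBase.mem_arm_of_adj_root {e : E} {r x : V} (hr : r ∈ R) (hrx : ends e = s(r, x)) :
    ∃ i, x ∈ A i := hb.root_edges e r x hr hrx

/-! ### The four avoidance lemmas -/

/-- **Red paths from a root visit roots and `true` arms only**: the set `R ∪ armsTrueC ω` is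
closed under red adjacency at the cube point `ω`. -/
lemma MultiBase.red_closed (ω : Config ι) {x y : V} (hx : x ∈ R ∪ armsTrueC A ω)
    (hxy : (openGraph ends (coreReal ends A ζ ω)).Adj x y) : y ∈ R ∪ armsTrueC A ω := by
  obtain ⟨_, e, he, hxy⟩ := exists_edge_of_adj hxy
  rcases hx with hx | ⟨i, hi, hx⟩
  · obtain ⟨j, hy⟩ := hb.mem_arm_of_adj_root hx hxy
    have := (hb.coreReal_root_edge hx hxy hy).1 he
    exact Or.inr ⟨j, this, hy⟩
  · by_cases hyR : y ∈ R
    · exact Or.inl hyR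
    by_cases hyH : y ∈ H
    · obtain ⟨j, hy⟩ := hb.arm_cover y hyH hyR
      have hij := hb.arm_eq_of_edge hxy hx hy
      subst hij
      exact Or.inr ⟨i, hi, hy⟩
    · exfalso
      have := (hb.coreReal_out_edge hxy hx hyH).1 he
      simp [hi] at this

/-- **Blue paths from a root visit roots and `false` arms only**. -/
lemma MultiBase.blue_closed (ω : Config ι) {x y : V} (hx : x ∈ R ∪ armsFalseC A ω)
    (hxy : (openGraph ends (blue (coreReal ends A ζ ω))).Adj x y) : y ∈ R ∪ armsFalseC A ω := by
  obtain ⟨_, e, he, hxy⟩ := exists_edge_of_adj hxy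
  rw [blue_eq_true_iff] at he
  rcases hx with hx | ⟨i, hi, hx⟩
  · obtain ⟨j, hy⟩ := hb.mem_arm_of_adj_root hx hxy
    have := hb.coreReal_root_edge (ω := ω) hx hxy hy
    refine Or.inr ⟨j, ?_, hy⟩
    by_contra hj
    rw [Bool.not_eq_false] at hj
    rw [this.2 hj] at he; simp at he
  · by_cases hyR : y ∈ R
    · exact Or.inl hyR
    by_cases hyH : y ∈ H
    · obtain ⟨j, hy⟩ := hb.arm_cover y hyH hyR
      have hij := hb.arm_eq_of_edge hxy hx hy
      subst hij
      exact Or.inr ⟨i, hi, hy⟩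
    · exfalso
      have := hb.coreReal_out_edge (ω := ω) hxy hx hyH
      rw [this.2 hi] at he; simp at he

/-- **Red paths from the outside visit outside vertices and `false` arms only** (never a root). -/
lemma MultiBase.red_closed_out (ω : Config ι) {x y : V} (hx : x ∈ Hᶜ ∪ armsFalseC A ω)
    (hxy : (openGraph ends (coreReal ends A ζ ω)).Adj x y) : y ∈ Hᶜ ∪ armsFalseC A ω := by
  obtain ⟨_, e, he, hxy⟩ := exists_edge_of_adj hxy
  rcases hx with hx | ⟨i, hi, hx⟩
  · by_cases hyH : y ∈ H
    · by_cases hyR : y ∈ R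
      · exfalso
        obtain ⟨j, hxj⟩ := hb.mem_arm_of_adj_root hyR (ends_swap hxy)
        exact hx (hb.arm_sub j x hxj).1
      · obtain ⟨j, hy⟩ := hb.arm_cover y hyH hyR
        have := (hb.coreReal_out_edge (ends_swap hxy) hy hx).1 he
        exact Or.inr ⟨j, this, hy⟩
    · exact Or.inl hyH
  · by_cases hyH : y ∈ H
    · by_cases hyR : y ∈ R
      · exfalso
        have := (hb.coreReal_root_edge hyR (ends_swap hxy) hx).1 he
        simp [hi] at this
      · obtain ⟨j, hy⟩ := hb.arm_cover y hyH hyR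
        have hij := hb.arm_eq_of_edge hxy hx hy
        subst hij
        exact Or.inr ⟨i, hi, hy⟩
    · exact Or.inl hyH

/-- **Blue paths from the outside visit outside vertices and `true` arms only** (never a root). -/
lemma MultiBase.blue_closed_out (ω : Config ι) {x y : V} (hx : x ∈ Hᶜ ∪ armsTrueC A ω)
    (hxy : (openGraph ends (blue (coreReal ends A ζ ω))).Adj x y) : y ∈ Hᶜ ∪ armsTrueC A ω := by
  obtain ⟨_, e, he, hxy⟩ := exists_edge_of_adj hxy
  rw [blue_eq_true_iff] at he
  rcases hx with hx | ⟨i, hi, hx⟩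
  · by_cases hyH : y ∈ H
    · by_cases hyR : y ∈ R
      · exfalso
        obtain ⟨j, hxj⟩ := hb.mem_arm_of_adj_root hyR (ends_swap hxy)
        exact hx (hb.arm_sub j x hxj).1
      · obtain ⟨j, hy⟩ := hb.arm_cover y hyH hyR
        have := hb.coreReal_out_edge (ω := ω) (ends_swap hxy) hy hx
        refine Or.inr ⟨j, ?_, hy⟩
        by_contra hj
        rw [Bool.not_eq_true] at hj
        rw [this.2 hj] at he; simp at he
    · exact Or.inl hyH
  · by_cases hyH : y ∈ H
    · by_cases hyR : y ∈ R
      · exfalso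
        have := hb.coreReal_root_edge (ω := ω) hyR (ends_swap hxy) hx
        rw [this.2 hi] at he; simp at he
      · obtain ⟨j, hy⟩ := hb.arm_cover y hyH hyR
        have hij := hb.arm_eq_of_edge hxy hx hy
        subst hij
        exact Or.inr ⟨i, hi, hy⟩
    · exact Or.inl hyH

/-- A vertex of the red cluster of a root at a cube point is a root or lies in a `true` arm. -/
theorem MultiBase.mem_root_or_true_of_mem_cluster (ω : Config ι) {r x : V} (hr : r ∈ R)
    (hx : x ∈ cluster ends (coreReal ends A ζ ω) r) : x ∈ R ∨ ∃ i, ω i = true ∧ x ∈ A i :=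
  mem_of_conn_of_closed (S := R ∪ armsTrueC A ω) (fun _ hx' _ hxy => hb.red_closed ω hx' hxy)
    (Or.inl hr) hx

/-- A vertex of the blue cluster of a root at a cube point is a root or lies in a `false` arm. -/
theorem MultiBase.mem_root_or_false_of_mem_cluster_blue (ω : Config ι) {r x : V} (hr : r ∈ R)
    (hx : x ∈ cluster ends (blue (coreReal ends A ζ ω)) r) :
    x ∈ R ∨ ∃ i, ω i = false ∧ x ∈ A i :=
  mem_of_conn_of_closed (S := R ∪ armsFalseC A ω) (fun _ hx' _ hxy => hb.blue_closed ω hx' hxy)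
    (Or.inl hr) hx

/-- A vertex of the red cluster of an outside vertex at a cube point is outside `H` or lies in a
`false` arm (never a root). -/
theorem MultiBase.mem_notMem_or_false_of_mem_cluster_out (ω : Config ι) {y x : V} (hy : y ∉ H)
    (hx : x ∈ cluster ends (coreReal ends A ζ ω) y) : x ∉ H ∨ ∃ i, ω i = false ∧ x ∈ A i :=
  mem_of_conn_of_closed (S := Hᶜ ∪ armsFalseC A ω)
    (fun _ hx' _ hxy => hb.red_closed_out ω hx' hxy) (Or.inl hy) hx

/-- A vertex of the blue cluster of an outside vertex at a cube point is outside `H` or lies in a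
`true` arm (never a root). -/
theorem MultiBase.mem_notMem_or_true_of_mem_cluster_blue_out (ω : Config ι) {y x : V} (hy : y ∉ H)
    (hx : x ∈ cluster ends (blue (coreReal ends A ζ ω)) y) : x ∉ H ∨ ∃ i, ω i = true ∧ x ∈ A i :=
  mem_of_conn_of_closed (S := Hᶜ ∪ armsTrueC A ω)
    (fun _ hx' _ hxy => hb.blue_closed_out ω hx' hxy) (Or.inl hy) hx

/-- A root is in neither cluster of an outside vertex at a cube point. -/
theorem MultiBase.root_notMem_cluster_out (ω : Config ι) {y r : V} (hy : y ∉ H) (hr : r ∈ R) :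
    r ∉ cluster ends (coreReal ends A ζ ω) y ∧ r ∉ cluster ends (blue (coreReal ends A ζ ω)) y := by
  constructor
  · intro hr'
    rcases hb.mem_notMem_or_false_of_mem_cluster_out ω hy hr' with h' | ⟨i, _, hi⟩
    · exact h' (hb.root_sub hr)
    · exact hb.root_notMem_arm hr i hi
  · intro hr'
    rcases hb.mem_notMem_or_true_of_mem_cluster_blue_out ω hy hr' with h' | ⟨i, _, hi⟩
    · exact h' (hb.root_sub hr)
    · exact hb.root_notMem_arm hr i hi

/-- The hull of a root at a cube point lies inside `H`. -/
theorem MultiBase.hull_subset (ω : Config ι) {r : V} (hr : r ∈ R) :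
    hull ends (coreReal ends A ζ ω) r ⊆ H := by
  rintro x (hx | hx)
  · rcases hb.mem_root_or_true_of_mem_cluster ω hr hx with h' | ⟨i, _, hi⟩
    · exact hb.root_sub h'
    · exact (hb.arm_sub i x hi).1
  · rcases hb.mem_root_or_false_of_mem_cluster_blue ω hr hx with h' | ⟨i, _, hi⟩
    · exact hb.root_sub h'
    · exact (hb.arm_sub i x hi).1

end Base

end LocRows

end Summit.Ventures.PercRepro2
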